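import Mathlib.Algebra.Central.Basic
import Mathlib.Analysis.Complex.Polynomial.Basic
import Mathlib.LinearAlgebra.Dimension.Constructions
import Mathlib.RingTheory.Flat.Basic
import Mathlib.RingTheory.SimpleModule.IsAlgClosed
import Mathlib.RingTheory.SimpleRing.Congr
import Mathlib.RingTheory.TensorProduct.Free
import Literature.NumberTheory.Automorphic.QuaternionAlgebraAdelic
import HarnessLib

/-!
# Quaternion algebras split at complex places; totally definite forces totally real

Companion ("proofs") file of `Literature.NumberTheory.Automorphic.QuaternionAlgebraAdelic`
(namespace `Literature.Automorphic`), disjoint from the Fujisaki companion `QuaternionAlgebraAdelicProofs`.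
It discharges, sorry-free, the two named facts

* `isSplitAtInfinite_of_isComplex` — a quaternion algebra `D` over a number field `K` is split at
  every complex place `w`: `K_w ⊗_K D ≃ₐ[K_w] M₂(K_w)`
  (`isSplitAtInfinite_of_isComplex_holds`);
* `isTotallyReal_of_isTotallyDefinite` — if `D` is totally definite (ramified at every infinite
  place) then `K` is totally real (`isTotallyReal_of_isTotallyDefinite_holds`; Vignéras, LNM 800,
  Ch. V §1 Exercice 1.1 (a)).

## Proof

Vignéras (Ch. I §1, p. 3; recalled in Ch. II §1, p. 31) argues with an explicit quaternion
structure `{L, θ}`: over a separably closed field the quadratic algebra `L` is not a field, so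
`H ≃ M(2, K)`. For the abstract class `IsQuaternionAlgebra K D` (central simple of dimension `4`)
we use instead the structure theory available in Mathlib:

1. **Base change of a central simple algebra is simple** (`IsSimpleRing.tensorProduct_of_isCentral`,
   Pierce, *Associative Algebras*, §12.4 Lemma b (ii); not in Mathlib at the pinned revision, proved
   here in general: `A ⊗[K] B` is simple for `A` central simple and `B` simple over a field `K`).
   The proof is the classical minimal-length argument in the `A`-basis `1 ⊗ 𝓑 i` of `A ⊗[K] B`
   (Mathlib `Algebra.TensorProduct.basis`).
2. **Wedderburn–Artin over an algebraically closed field** (Mathlib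
   `IsSimpleRing.exists_algEquiv_matrix_of_isAlgClosed`): `L ⊗_K D ≃ₐ[L] Mₙ(L)`, and
   `n² = dim_L (L ⊗_K D) = dim_K D = 4` (Mathlib `Module.finrank_baseChange`) forces `n = 2`
   (`nonempty_algEquiv_matrix_of_isAlgClosed`).
3. A complex place `w` has `K_w ≃+* ℂ` (Mathlib
   `NumberField.InfinitePlace.Completion.ringEquivComplexOfIsComplex`), so `K_w` is algebraically
   closed and (2) applies; a totally definite `D` therefore admits no complex place.

## References

* M.-F. Vignéras, *Arithmétique des algèbres de quaternions*, LNM 800 (1980): Ch. I §1 p. 3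
  ("Sur un corps séparablement clos, M(2,K) est la seule algèbre de quaternions"), Ch. II §1 p. 31,
  Ch. III §3 (ramification), Ch. V §1 Exercice 1.1 (a) ("Montrer que K est totalement réel").
* R. S. Pierce, *Associative Algebras*, GTM 88 (1982), §12.4 Lemma b (ii).
-/

noncomputable section

open scoped TensorProduct

namespace Literature.NumberTheory.Automorphic

/-! ### The tensor product of a central simple algebra with a simple algebra is simple -/

section TensorSimple

variable {K : Type*} [Field K] {A : Type*} [Ring A] [Algebra K A] {B : Type*} [Ring B] [Algebra K B]
  {ι : Type*}

/-- Coordinates in the `A`-basis `1 ⊗ 𝓑 i` of `A ⊗[K] B` (Mathlib `Algebra.TensorProduct.basis`)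
are left `A`-linear: the `i`-th coordinate of `(u ⊗ 1) x` is `u` times that of `x`. [folklore] -/
theorem basis_repr_tmul_one_mul (𝓑 : Module.Basis ι K B) (u : A) (x : A ⊗[K] B) (i : ι) :
    (Algebra.TensorProduct.basis A 𝓑).repr ((u ⊗ₜ[K] (1 : B)) * x) i =
      u * (Algebra.TensorProduct.basis A 𝓑).repr x i := by
  induction x using TensorProduct.induction_on with
  | zero => simp
  | tmul a b =>
    simp only [Algebra.TensorProduct.tmul_mul_tmul, one_mul,
      Algebra.TensorProduct.basis_repr_tmul, Finsupp.smul_apply, Finsupp.mapRange_apply,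
      smul_eq_mul, mul_assoc]
  | add x y hx hy => simp only [mul_add, map_add, Finsupp.add_apply, hx, hy]

/-- The `i`-th coordinate of `x (v ⊗ 1)` in the `A`-basis `1 ⊗ 𝓑 i` of `A ⊗[K] B` is that of `x`
times `v` (the scalars `K` being central in `A`). [folklore] -/
theorem basis_repr_mul_tmul_one (𝓑 : Module.Basis ι K B) (v : A) (x : A ⊗[K] B) (i : ι) :
    (Algebra.TensorProduct.basis A 𝓑).repr (x * (v ⊗ₜ[K] (1 : B))) i =
      (Algebra.TensorProduct.basis A 𝓑).repr x i * v := by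
  induction x using TensorProduct.induction_on with
  | zero => simp
  | tmul a b =>
    simp only [Algebra.TensorProduct.tmul_mul_tmul, mul_one,
      Algebra.TensorProduct.basis_repr_tmul, Finsupp.smul_apply, Finsupp.mapRange_apply,
      smul_eq_mul, mul_assoc, Algebra.commutes]
  | add x y hx hy => simp only [add_mul, map_add, Finsupp.add_apply, hx, hy]

open Classical in
/-- **The tensor product of a central simple algebra with a simple algebra is simple**
(Pierce, *Associative Algebras*, §12.4 Lemma b (ii)): if `A` is a central simple algebra over a
field `K` and `B` is a simple `K`-algebra, then `A ⊗[K] B` is a simple ring.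
Proof (classical minimal-length argument): a non-zero element of a two-sided ideal `I` of minimal
length in the `A`-basis `1 ⊗ 𝓑 i` can be normalised, using simplicity of `A`, to have one
coordinate equal to `1`; its commutators with `a ⊗ 1` are then shorter elements of `I`, hence
zero, so all its coordinates are central, i.e. it is `1 ⊗ b` with `b ≠ 0`; simplicity of `B` then
puts `1 ⊗ 1` in `I`. [cite: Pierce1982, §12.4 Lemma b (ii)] -/
theorem IsSimpleRing.tensorProduct_of_isCentral
    [Algebra.IsCentral K A] [IsSimpleRing A] [IsSimpleRing B] : IsSimpleRing (A ⊗[K] B) := by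
  let 𝓑 := Module.Free.chooseBasis K B
  let ℰ : Module.Basis _ A (A ⊗[K] B) := Algebra.TensorProduct.basis A 𝓑
  haveI : Nontrivial (A ⊗[K] B) :=
    (Algebra.TensorProduct.includeRight_injective
      (FaithfulSMul.algebraMap_injective K A)).nontrivial
  refine .of_eq_bot_or_eq_top fun I ↦ ?_
  rw [or_iff_not_imp_left, ← I.one_mem_iff]
  intro hI
  -- Step 1: a non-zero element `x ∈ I` of minimal length (number of non-zero coordinates).
  have hex : ∃ n, ∃ x ∈ I, x ≠ 0 ∧ (ℰ.repr x).support.card = n := by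
    obtain ⟨x, hxI, hx0⟩ := SetLike.exists_of_lt (bot_lt_iff_ne_bot.mpr hI : ⊥ < I)
    exact ⟨_, x, hxI, hx0, rfl⟩
  obtain ⟨x, hxI, hx0, hxn⟩ := Nat.find_spec hex
  have hmin : ∀ y ∈ I, y ≠ 0 → (ℰ.repr x).support.card ≤ (ℰ.repr y).support.card :=
    fun y hy hy0 ↦ hxn ▸ Nat.find_min' hex ⟨y, hy, hy0, rfl⟩
  obtain ⟨i₀, hi₀⟩ : (ℰ.repr x).support.Nonempty := by
    rw [Finsupp.support_nonempty_iff, ne_eq, LinearEquiv.map_eq_zero_iff]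
    exact hx0
  -- Step 2: the `i₀`-th coordinates of the elements of `I` supported inside `supp x` form a
  -- two-sided ideal of `A` containing the non-zero coordinate `x_{i₀}`, hence containing `1`.
  let J : TwoSidedIdeal A := TwoSidedIdeal.mk'
    {a | ∃ y ∈ I, (ℰ.repr y).support ⊆ (ℰ.repr x).support ∧ ℰ.repr y i₀ = a}
    ⟨0, I.zero_mem, by simp, by simp⟩
    (by
      rintro _ _ ⟨y, hy, hys, rfl⟩ ⟨z, hz, hzs, rfl⟩
      exact ⟨y + z, I.add_mem hy hz,
        by rw [map_add]; exact Finsupp.support_add.trans (Finset.union_subset hys hzs),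
        by rw [map_add, Finsupp.add_apply]⟩)
    (by
      rintro _ ⟨y, hy, hys, rfl⟩
      exact ⟨-y, I.neg_mem hy, by rw [map_neg, Finsupp.support_neg]; exact hys,
        by rw [map_neg, Finsupp.neg_apply]⟩)
    (by
      rintro u _ ⟨y, hy, hys, rfl⟩
      refine ⟨(u ⊗ₜ[K] (1 : B)) * y, I.mul_mem_left _ _ hy, fun i hi ↦ hys ?_, ?_⟩
      · rw [Finsupp.mem_support_iff] at hi ⊢
        rw [basis_repr_tmul_one_mul] at hi
        exact fun h ↦ hi (by rw [h, mul_zero])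
      · rw [basis_repr_tmul_one_mul])
    (by
      rintro _ v ⟨y, hy, hys, rfl⟩
      refine ⟨y * (v ⊗ₜ[K] (1 : B)), I.mul_mem_right _ _ hy, fun i hi ↦ hys ?_, ?_⟩
      · rw [Finsupp.mem_support_iff] at hi ⊢
        rw [basis_repr_mul_tmul_one] at hi
        exact fun h ↦ hi (by rw [h, zero_mul])
      · rw [basis_repr_mul_tmul_one])
  have hJ1 : (1 : A) ∈ J := by
    refine IsSimpleRing.one_mem_of_ne_zero_mem J (Finsupp.mem_support_iff.mp hi₀) ?_
    rw [TwoSidedIdeal.mem_mk']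
    exact ⟨x, hxI, subset_rfl, rfl⟩
  obtain ⟨y, hyI, hys, hy1⟩ :
      ∃ y ∈ I, (ℰ.repr y).support ⊆ (ℰ.repr x).support ∧ ℰ.repr y i₀ = 1 := by
    rw [TwoSidedIdeal.mem_mk'] at hJ1
    exact hJ1
  -- Step 3: the commutators of `y` with `a ⊗ 1` lie in `I` and are strictly shorter than `x`,
  -- hence vanish by minimality: every coordinate of `y` is central.
  have hcomm : ∀ (a : A) (i), a * ℰ.repr y i = ℰ.repr y i * a := by
    intro a i
    set z := (a ⊗ₜ[K] (1 : B)) * y - y * (a ⊗ₜ[K] (1 : B)) with hz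
    have hzI : z ∈ I := I.sub_mem (I.mul_mem_left _ _ hyI) (I.mul_mem_right _ _ hyI)
    have hzrepr : ∀ j, ℰ.repr z j = a * ℰ.repr y j - ℰ.repr y j * a := fun j ↦ by
      rw [hz, map_sub, Finsupp.sub_apply, basis_repr_tmul_one_mul, basis_repr_mul_tmul_one]
    by_contra hne
    have hz0 : z ≠ 0 := by
      intro h
      apply hne
      have := hzrepr i
      rw [h, map_zero, Finsupp.zero_apply] at this
      exact sub_eq_zero.mp this.symm
    have hlt : (ℰ.repr z).support.card < (ℰ.repr x).support.card := by
      apply Finset.card_lt_card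
      refine ⟨fun j hj ↦ hys ?_, Finset.not_subset.mpr ⟨i₀, hi₀, ?_⟩⟩
      · rw [Finsupp.mem_support_iff] at hj ⊢
        rw [hzrepr] at hj
        exact fun h ↦ hj (by rw [h, mul_zero, zero_mul, sub_zero])
      · rw [Finsupp.mem_support_iff, not_not, hzrepr, hy1, mul_one, one_mul, sub_self]
    exact absurd (hmin z hzI hz0) (not_le.mpr hlt)
  have hcen : ∀ i, ∃ k : K, algebraMap K A k = ℰ.repr y i := fun i ↦ by
    have hi : ℰ.repr y i ∈ Subalgebra.center K A :=
      Subalgebra.mem_center_iff.mpr fun a ↦ hcomm a i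
    rw [Algebra.IsCentral.center_eq_bot, Algebra.mem_bot] at hi
    exact hi
  choose k hk using hcen
  -- Step 4: hence `y = 1 ⊗ b` with `b ≠ 0`.
  set b : B := ∑ i ∈ (ℰ.repr y).support, k i • 𝓑 i with hb
  have hyb : y = (1 : A) ⊗ₜ[K] b := by
    conv_lhs => rw [← ℰ.linearCombination_repr y, Finsupp.linearCombination_apply, Finsupp.sum]
    rw [hb, TensorProduct.tmul_sum]
    refine Finset.sum_congr rfl fun i _ ↦ ?_
    rw [← hk i, Algebra.TensorProduct.basis_repr_symm_apply', Algebra.algebraMap_eq_smul_one,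
      TensorProduct.smul_tmul]
  have hy0 : y ≠ 0 := by
    rintro rfl
    rw [map_zero, Finsupp.zero_apply] at hy1
    exact zero_ne_one hy1
  have hb0 : b ≠ 0 := by
    rintro h
    rw [h, TensorProduct.tmul_zero] at hyb
    exact hy0 hyb
  -- Step 5: `{b' | 1 ⊗ b' ∈ I}` is a two-sided ideal of `B` containing `b ≠ 0`, hence `1`.
  let J' : TwoSidedIdeal B := TwoSidedIdeal.mk' {b' | (1 : A) ⊗ₜ[K] b' ∈ I}
    (by simp only [Set.mem_setOf_eq, TensorProduct.tmul_zero]; exact I.zero_mem)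
    (by
      intro b₁ b₂ h₁ h₂
      simp only [Set.mem_setOf_eq, TensorProduct.tmul_add]
      exact I.add_mem h₁ h₂)
    (by
      intro b₁ h₁
      simp only [Set.mem_setOf_eq, TensorProduct.tmul_neg]
      exact I.neg_mem h₁)
    (by
      intro b₁ b₂ h₂
      have := I.mul_mem_left ((1 : A) ⊗ₜ[K] b₁) _ h₂
      rwa [Algebra.TensorProduct.tmul_mul_tmul, one_mul] at this)
    (by
      intro b₁ b₂ h₁
      have := I.mul_mem_right _ ((1 : A) ⊗ₜ[K] b₂) h₁
      rwa [Algebra.TensorProduct.tmul_mul_tmul, one_mul] at this)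
  have h1J' : (1 : B) ∈ J' := by
    refine IsSimpleRing.one_mem_of_ne_zero_mem J' hb0 ?_
    rw [TwoSidedIdeal.mem_mk']
    show (1 : A) ⊗ₜ[K] b ∈ I
    exact hyb ▸ hyI
  rw [TwoSidedIdeal.mem_mk'] at h1J'
  exact h1J'

/-- Symmetric form: `B ⊗[K] A` is simple for `B` simple and `A` central simple over the field `K`
(transport of `IsSimpleRing.tensorProduct_of_isCentral` along `Algebra.TensorProduct.comm`); this
is the shape `L ⊗_K D` of `ScalarExtension K L D`. [cite: Pierce1982, §12.4 Lemma b (ii)] -/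
theorem IsSimpleRing.tensorProduct_of_isCentral'
    [Algebra.IsCentral K A] [IsSimpleRing A] [IsSimpleRing B] : IsSimpleRing (B ⊗[K] A) :=
  IsSimpleRing.of_ringEquiv (Algebra.TensorProduct.comm K A B).toRingEquiv
    IsSimpleRing.tensorProduct_of_isCentral

end TensorSimple

/-! ### Splitting over algebraically closed fields and at complex places -/

section SplitAlgClosed

variable {K : Type*} [Field K] (D : Type*) [Ring D] [Algebra K D] (L : Type*) [Field L]
  [Algebra K L]

/-- Over an algebraically closed field `L ⊇ K` a quaternion algebra `D` over `K` splits: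
`L ⊗_K D ≃ₐ[L] M₂(L)`. Indeed `L ⊗_K D` is simple (`IsSimpleRing.tensorProduct_of_isCentral'`)
and `4`-dimensional over `L` (Mathlib `Module.finrank_baseChange`), so by Wedderburn–Artin over an
algebraically closed field (Mathlib `IsSimpleRing.exists_algEquiv_matrix_of_isAlgClosed`) it is
`Mₙ(L)` with `n² = 4`. This is Vignéras' remark "sur un corps séparablement clos, `M(2,K)` est la
seule algèbre de quaternions" (for algebraically closed `L`).
[cite: VignerasLNM800, Ch. I §1 p. 3] -/
theorem nonempty_algEquiv_matrix_of_isAlgClosed [IsAlgClosed L] [IsQuaternionAlgebra K D] :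
    Nonempty (ScalarExtension K L D ≃ₐ[L] Matrix (Fin 2) (Fin 2) L) := by
  haveI := IsQuaternionAlgebra.isSimpleRing' K D
  haveI hs : IsSimpleRing (L ⊗[K] D) := IsSimpleRing.tensorProduct_of_isCentral'
  haveI : IsSimpleRing (ScalarExtension K L D) := hs
  obtain ⟨n, _, ⟨e⟩⟩ :=
    IsSimpleRing.exists_algEquiv_matrix_of_isAlgClosed L (ScalarExtension K L D)
  have h4 : Module.finrank L (ScalarExtension K L D) = 4 :=
    (Module.finrank_baseChange (R := L) (S := K) (M' := D)).trans
      (IsQuaternionAlgebra.finrank_eq_four (K := K) (D := D))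
  have hn : Module.finrank L (ScalarExtension K L D) = n * n := by
    rw [e.toLinearEquiv.finrank_eq, Module.finrank_matrix, Module.finrank_self, Fintype.card_fin,
      mul_one]
  obtain rfl : n = 2 := Nat.mul_self_inj.mp (by omega)
  exact ⟨e⟩

end SplitAlgClosed

section InfinitePlaces

open NumberField

universe u

-- `K : Type` as in `QuaternionAlgebraAdelic` (the named facts quantify over `K : Type`); the facts
-- and their proofs only use `Field K` (infinite places and their completions need no more).
variable {K : Type} [Field K] (D : Type u) [Ring D] [Algebra K D]

/-- **Discharge** of `isSplitAtInfinite_of_isComplex`: a quaternion algebra over a number field is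
split at every complex place `w`, since `K_w ≃+* ℂ` (Mathlib
`NumberField.InfinitePlace.Completion.ringEquivComplexOfIsComplex`) is algebraically closed and
`nonempty_algEquiv_matrix_of_isAlgClosed` applies (Vignéras: "M(2,ℂ) est la seule algèbre de
quaternions sur ℂ", Ch. II §1 p. 31, from Ch. I §1 p. 3; complex places are never ramified,
Ch. III §3). Only `Field K` is needed. [cite: VignerasLNM800, Ch. II §1 p. 31 and Ch. I §1 p. 3] -/
theorem isSplitAtInfinite_of_isComplex_holds : isSplitAtInfinite_of_isComplex (K := K) D := by
  intro _ w hw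
  haveI : IsAlgClosed w.Completion :=
    IsAlgClosed.of_ringEquiv ℂ w.Completion
      (InfinitePlace.Completion.ringEquivComplexOfIsComplex hw).symm
  exact nonempty_algEquiv_matrix_of_isAlgClosed D w.Completion

variable (K) in
/-- **Discharge** of `isTotallyReal_of_isTotallyDefinite`: the base field of a totally definite
quaternion algebra over a number field is totally real — a complex place would be split
(`isSplitAtInfinite_of_isComplex_holds`), contradicting ramification at every infinite place.
This is Vignéras, Ch. V §1 Exercice 1.1 (a) ("Montrer que K est totalement réel (i.e. toutes ses
places archimédiennes sont réelles)", for `H/K` ramified at all archimedean places).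
[cite: VignerasLNM800, Ch. V §1 Exercice 1.1 (a)] -/
theorem isTotallyReal_of_isTotallyDefinite_holds : isTotallyReal_of_isTotallyDefinite K D := by
  intro _ h
  refine ⟨fun w ↦ ?_⟩
  by_contra hw
  exact h w (isSplitAtInfinite_of_isComplex_holds D w
    (InfinitePlace.not_isReal_iff_isComplex.mp hw))

end InfinitePlaces

end Literature.NumberTheory.Automorphic
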